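import Mathlib
import Summits.Ventures.HodgeRepro2.T5AdicCompletionIntegral
import Summits.Ventures.HodgeRepro2.T5AdicCompletionResidueField
import Summits.Ventures.HodgeRepro2.T5LocalUnitsProfinite

/-!
# T5AdicCompletionLocalField — Mathlib's number-field completion `v.adicCompletion K` IS the
cell's local-field object (at every finite place)

Blind cell pub-hodge-repro2, seat p4 (Tier-5 Lean support, annex growth only).
Declaration per README §8(d): uses an L-value-free non-vanishing device: NO.

The Haar / Gauss-sum / ε files of this cell (p7's `T5LocalFieldHaar`, `T5EpsilonLocalField`, …, and
this seat's `T5LocalUnitsProfinite`) work on an ABSTRACT local field: `K` a complete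
`NontriviallyNormedField` with `IsUltrametricDist`, whose ring of integers `𝒪[K] = Valued.integer K`
(for the `ℝ≥0`-valued `NormedField.toValued`) is a DVR with finite residue field `𝓀[K]`. p7's
`T5PadicLocalField` instantiated that object on Mathlib's `ℚ_[p]` (degree-one places). This file
instantiates it on Mathlib's `v.adicCompletion K` for EVERY finite place `v` of a number field:

* the `ℝ≥0`-integers of the norm are the `ℤᵐ⁰`-integers `adicCompletionIntegers` as subrings
  (`integer_eq`; both are `{x | ‖x‖ ≤ 1}`, p395866's `mem_adicCompletionIntegers_iff_norm_le_one`);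
* hence `𝒪[Kv] ≃+* O_Kv` (`integerEquiv`), the DVR property transports
  (`isDiscreteValuationRing_integer`), the residue fields agree (`residueFieldEquiv`) and are finite
  (p396054), of cardinality `N(v)` (`card_residueField`);
* with p395866's `NontriviallyNormedField Kv`, Mathlib's `CompleteSpace` / `IsUltrametricDist`,
  every theorem of the abstract object applies by instance search — e.g.
  `CompactSpace 𝒪[Kv]` (`compactSpace_integer`, from `T5LocalUnitsProfinite`).

The two `Valued` structures on `Kv` (Mathlib's adic `ℤᵐ⁰` one and the norm's `ℝ≥0` one) are kept
apart by writing `NormedField.toValued` explicitly; nothing is re-declared. Nothing here is asserted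
about the Tier-5 datum.
-/

namespace Summit.Ventures.HodgeRepro2.T5AdicCompletionLocalField

open IsDedekindDomain HeightOneSpectrum NumberField IsLocalRing
open scoped NNReal

variable {K : Type*} [Field K] [NumberField K] (v : HeightOneSpectrum (𝓞 K))

/-- The `ℝ≥0`-valued valuation of the norm, as used by the abstract local-field object. -/
noncomputable abbrev normValued : Valued (v.adicCompletion K) ℝ≥0 := NormedField.toValued

/-- The ring of integers of the norm's valuation is `adicCompletionIntegers`, as subrings of
`Kv`: both are the closed unit ball `{x | ‖x‖ ≤ 1}`. -/
theorem integer_eq :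
    (Valued.integer (v.adicCompletion K) (vK := normValued v) : Subring (v.adicCompletion K)) =
      (v.adicCompletionIntegers K).toSubring := by
  ext x
  rw [Valuation.mem_integer_iff, ValuationSubring.mem_toSubring,
    T5AdicCompletionIntegral.mem_adicCompletionIntegers_iff_norm_le_one]
  change ‖x‖₊ ≤ 1 ↔ ‖x‖ ≤ 1
  exact NNReal.coe_le_one.symm

/-- `𝒪[Kv] ≃+* O_Kv`. -/
noncomputable def integerEquiv :
    (Valued.integer (v.adicCompletion K) (vK := normValued v)) ≃+* v.adicCompletionIntegers K :=
  RingEquiv.subringCongr (integer_eq v)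

/-- `𝒪[Kv]` is a DVR (transported from Mathlib's DVR instance on `adicCompletionIntegers`). -/
instance isDiscreteValuationRing_integer :
    IsDiscreteValuationRing (Valued.integer (v.adicCompletion K) (vK := normValued v)) :=
  IsDiscreteValuationRing.RingEquivClass.isDiscreteValuationRing (integerEquiv v).symm

/-- `𝓀[Kv] ≃+* 𝓀(O_Kv)`. -/
noncomputable def residueFieldEquiv :
    (Valued.ResidueField (v.adicCompletion K) (vK := normValued v)) ≃+*
      ResidueField (v.adicCompletionIntegers K) :=
  IsLocalRing.ResidueField.mapEquiv (integerEquiv v)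

/-- `𝓀[Kv]` is finite (p396054 through `residueFieldEquiv`). -/
instance finite_residueField :
    Finite (Valued.ResidueField (v.adicCompletion K) (vK := normValued v)) :=
  Finite.of_equiv _ (residueFieldEquiv v).symm.toEquiv

/-- `|𝓀[Kv]| = N(v)`. -/
theorem card_residueField :
    Nat.card (Valued.ResidueField (v.adicCompletion K) (vK := normValued v)) =
      Ideal.absNorm v.asIdeal := by
  rw [Nat.card_congr (residueFieldEquiv v).toEquiv,
    T5AdicCompletionResidueField.card_residueField]

/-- THE INSTANTIATION: the abstract object's theorems apply to `Kv` by instance search — here the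
compactness of `𝒪[Kv]` (`T5LocalUnitsProfinite.compactSpace_integer`: complete, DVR, finite
residue field). -/
theorem compactSpace_integer :
    CompactSpace (Valued.integer (v.adicCompletion K) (vK := normValued v)) :=
  T5LocalUnitsProfinite.compactSpace_integer

end Summit.Ventures.HodgeRepro2.T5AdicCompletionLocalField
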